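import Summits.ResolutionOfSingularities.ResolutionOfSingularities.Theorems.FrobeniusLadderFRationalResolutionChartHloc
import Summits.ResolutionOfSingularities.ResolutionOfSingularities.Theorems.FrobeniusLadderFRationalResolutionFibreReduced
import Summits.ResolutionOfSingularities.ResolutionOfSingularities.Theorems.FrobeniusLadderFRationalResolutionIsolatedGlue
import Mathlib.RingTheory.Flat.Localization
import Mathlib.RingTheory.Localization.Away.AdjoinRoot
import HarnessLib

/-!
# Crux `FrobeniusLadder.FRationalResolution` (stmt-ResolutionOfSingularities-15317), line `redirect`,
# stub `stub_diagonalizableQuotientResolution` — isolated singularities resolved ÉTALE-LOCALLY by ONE point blow-up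

Assembly of the T3 chain (FibreReduced → BlowupFlatCriteria/ChartTransfer → ChartHloc → IsolatedGlue) in the case
where the chart-side centre is the (reduced) point itself: the centre `𝔪_x` is CANONICAL, so no residue-field
condition is needed — for an étale (flat, finitely presented, unramified at the point) chart `Spec C → Spec B ⊆ X`
through an isolated singular closed point `x = ι 𝔭` with `𝔔 ↦ 𝔭`, `Bl_𝔭 ×_B C_g = Bl_{𝔭 C_g} = Bl_{𝔔 C_g}` for
`g ∉ 𝔔` killing the rest of the fibre, and regularity descends (fpqc).

* `hloc_of_pointBlowup_flat_chart_away` / `hloc_of_pointBlowup_flat_chart` — if `Bl_𝔔(Spec C)` is regular then `x`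
  has the local resolution datum `hloc` (basic-open form / unramified form);
* **`hasResolution_of_pointBlowup_flat_charts`** — an integral `X` locally of finite type over ANY field with finitely
  many singular points, each admitting such a chart, HAS A RESOLUTION OF SINGULARITIES. Instances: charts by Veronese
  cones `𝔸ⁿ/μ_r` (weights `(1,…,1)`, tame or wild), whose vertex is resolved by one blow-up of the vertex
  (c5's cone programme, `…VeroneseStalks.lean` for Zariski germs) — now with ÉTALE charts and arbitrary residue field
  extensions, i.e. the stub `stub_diagonalizableQuotientResolution` for isolated singularities with charts of weights
  `(1,…,1)` once the chart ring map is extracted from the étale morphism.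

Honest label: assembly (no stub closed by name). No definitions, no named facts, no sorry.
[folklore; cite: Kollar2007, §2.2; GortzWedhorn2020, Prop. 13.91]
-/

noncomputable section

-- single-problem summit: the doubled namespace component is forced
set_option linter.dupNamespace false

open CategoryTheory AlgebraicGeometry TopologicalSpace
open Literature.AlgebraicGeometry.Resolution

namespace Summit.ResolutionOfSingularities.ResolutionOfSingularities.Theorems.FRationalResolution.PointBlowupEtale

/-- **`hloc` at an isolated singular point from a flat chart on which the blow-up of the point is regular — basic-open
form.** Data: `ι : Spec B → X` an affine open over `k` (`B` a domain of finite type over `k`), `𝔭 ⊆ B` maximal, `≠ 0`,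
with `ι 𝔭` singular and all other points of `Spec B` regular; `C` a flat finitely presented `B`-algebra with a prime
`𝔔` over `𝔭`, `g ∉ 𝔔` with `𝔔 C_g ≤ 𝔭 C_g` (over `D(g)` the fibre of `𝔭` is the reduced point `𝔔`), and
`Bl_𝔔(Spec C)` regular. Then `ι 𝔭` has an open neighbourhood `V` with a proper `ρ : Y → V`, `Y` regular, an
isomorphism over `V ∩ Reg X` with dense preimage. No residue-field condition: the centre `𝔪_x` is canonical.
[cite: Kollar2007, §2.2] [cite: GortzWedhorn2020, Prop. 13.91 (2)] -/
theorem hloc_of_pointBlowup_flat_chart_away (k : Type) [Field k] (X : Scheme.{0}) [IsIntegral X]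
    (f : X ⟶ Spec (.of k)) [LocallyOfFiniteType f]
    {B C : Type} [CommRing B] [CommRing C] [Algebra B C] [IsDomain B] [Algebra k B] [Algebra.FiniteType k B]
    [Module.Flat B C] [Algebra.FinitePresentation B C]
    (ι : Spec (.of B) ⟶ X) [IsOpenImmersion ι] (hι : ι ≫ f = Spec.map (CommRingCat.ofHom (algebraMap k B)))
    (𝔭 : Ideal B) [h𝔭 : 𝔭.IsMaximal] (h𝔭0 : 𝔭 ≠ ⊥)
    (hsing : ι ⟨𝔭, h𝔭.isPrime⟩ ∉ Scheme.regularLocus X)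
    (hregB : ∀ P : Spec (.of B), P.asIdeal ≠ 𝔭 → P ∈ Scheme.regularLocus (Spec (.of B)))
    (𝔔 : Ideal C) [h𝔔 : 𝔔.IsPrime] (hover : 𝔭 ≤ 𝔔.comap (algebraMap B C))
    (g : C) (hg : g ∉ 𝔔)
    (hle : 𝔔.map (algebraMap C (Localization.Away g)) ≤
      𝔭.map ((algebraMap C (Localization.Away g)).comp (algebraMap B C)))
    (hregQ : Scheme.IsRegular (affineBlowup 𝔔)) :
    ∃ (V : X.Opens), ι ⟨𝔭, h𝔭.isPrime⟩ ∈ V ∧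
      (∀ t : X, t ∉ Scheme.regularLocus X → t ∈ V → t = ι ⟨𝔭, h𝔭.isPrime⟩) ∧
      ∃ (Y : Scheme.{0}) (ρ : Y ⟶ V), IsProper ρ ∧ Scheme.IsRegular Y ∧
        IsIso (ρ ∣_ (V.ι ⁻¹ᵁ ⟨Scheme.regularLocus X, isOpen_regularLocus_of_locallyOfFiniteType_field f⟩)) ∧
        Dense ((ρ ⁻¹ᵁ (V.ι ⁻¹ᵁ ⟨Scheme.regularLocus X,
          isOpen_regularLocus_of_locallyOfFiniteType_field f⟩) : Y.Opens) : Set Y) := by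
  haveI : IsNoetherianRing B := Algebra.FiniteType.isNoetherianRing k B
  haveI : Algebra.FinitePresentation B (Localization.Away g) :=
    haveI := IsLocalization.Away.finitePresentation g (S := Localization.Away g)
    Algebra.FinitePresentation.trans B C (Localization.Away g)
  haveI : IsOpenImmersion (Spec.map (CommRingCat.ofHom (algebraMap C (Localization.Away g)))) :=
    IsOpenImmersion.of_isLocalization g
  have halg : algebraMap B (Localization.Away g) =
      (algebraMap C (Localization.Away g)).comp (algebraMap B C) := IsScalarTower.algebraMap_eq B C _
  -- `𝔭 C_g = 𝔔 C_g`
  have hpQ : 𝔭.map (algebraMap B (Localization.Away g)) = 𝔔.map (algebraMap C (Localization.Away g)) := by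
    apply le_antisymm
    · rw [halg, ← Ideal.map_map]
      exact Ideal.map_mono (Ideal.map_le_iff_le_comap.mpr hover)
    · rw [halg]; exact hle
  -- the blow-up of `𝔭 C_g = 𝔔 C_g` is an open piece of `Bl_𝔔`, hence regular
  have hregC : Scheme.IsRegular (affineBlowup (𝔭.map (algebraMap B (Localization.Away g)))) := by
    rw [hpQ]
    exact BlowupFlatCriteria.isRegular_affineBlowup_map_of_isOpenImmersion _ 𝔔 hregQ
  -- `𝔭` is in the image of the shrunk chart (witness: `𝔔 C_g`)
  have hdisj : Disjoint ((Submonoid.powers g : Submonoid C) : Set C) (𝔔 : Set C) := by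
    refine Set.disjoint_left.mpr ?_
    rintro x ⟨m, rfl⟩ hx
    exact hg (h𝔔.mem_of_pow_mem m hx)
  haveI hQ'prime : (𝔔.map (algebraMap C (Localization.Away g))).IsPrime :=
    IsLocalization.isPrime_of_isPrime_disjoint (Submonoid.powers g) _ 𝔔 h𝔔 hdisj
  have hcomapQ : 𝔔.comap (algebraMap B C) = 𝔭 :=
    (h𝔭.eq_of_le (Ideal.IsPrime.ne_top inferInstance) hover).symm
  have h𝔭C : (⟨𝔭, h𝔭.isPrime⟩ : PrimeSpectrum B) ∈
      Set.range (PrimeSpectrum.comap (algebraMap B (Localization.Away g))) := by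
    have hQQ : (𝔔.map (algebraMap C (Localization.Away g))).comap (algebraMap C (Localization.Away g)) = 𝔔 :=
      IsLocalization.under_map_of_isPrime_disjoint (Submonoid.powers g) (Localization.Away g) h𝔔 hdisj
    refine ⟨⟨𝔔.map (algebraMap C (Localization.Away g)), hQ'prime⟩, ?_⟩
    ext1
    change (𝔔.map (algebraMap C (Localization.Away g))).comap (algebraMap B (Localization.Away g)) = 𝔭
    rw [halg, ← Ideal.comap_comap, hQQ]
    exact hcomapQ
  -- `𝔭` is singular on `Spec B`
  have hsingB : (⟨𝔭, h𝔭.isPrime⟩ : Spec (.of B)) ∉ Scheme.regularLocus (Spec (.of B)) :=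
    fun hreg => hsing ((mem_regularLocus_iff_of_flat_of_isPreimmersion ι _).mp hreg)
  exact ChartHloc.hloc_of_flat_chart k X f (C := Localization.Away g) ι hι 𝔭 𝔭
    (IsNoetherian.noetherian 𝔭) h𝔭0 (n := 1) (by rw [pow_one]) le_rfl h𝔭C hregC hsingB hregB

/-- **`hloc` at an isolated singular point from a flat chart UNRAMIFIED at the point on which the blow-up of the point
is regular** (`𝔭 C_𝔔 = 𝔪_{C_𝔔}`, Mathlib `Algebra.isUnramifiedAt_iff_map_eq`; the basic open of the previous
theorem is produced by `…FibreReduced.exists_away_fibre_reduced`). [cite: Kollar2007, §2.2] -/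
theorem hloc_of_pointBlowup_flat_chart (k : Type) [Field k] (X : Scheme.{0}) [IsIntegral X]
    (f : X ⟶ Spec (.of k)) [LocallyOfFiniteType f]
    {B C : Type} [CommRing B] [CommRing C] [Algebra B C] [IsDomain B] [Algebra k B] [Algebra.FiniteType k B]
    [Module.Flat B C] [Algebra.FinitePresentation B C]
    (ι : Spec (.of B) ⟶ X) [IsOpenImmersion ι] (hι : ι ≫ f = Spec.map (CommRingCat.ofHom (algebraMap k B)))
    (𝔭 : Ideal B) [h𝔭 : 𝔭.IsMaximal] (h𝔭0 : 𝔭 ≠ ⊥)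
    (hsing : ι ⟨𝔭, h𝔭.isPrime⟩ ∉ Scheme.regularLocus X)
    (hregB : ∀ P : Spec (.of B), P.asIdeal ≠ 𝔭 → P ∈ Scheme.regularLocus (Spec (.of B)))
    (𝔔 : Ideal C) [h𝔔 : 𝔔.IsPrime] (hover : 𝔭 ≤ 𝔔.comap (algebraMap B C))
    (hunr : 𝔭.map (algebraMap B (Localization.AtPrime 𝔔)) =
      IsLocalRing.maximalIdeal (Localization.AtPrime 𝔔))
    (hregQ : Scheme.IsRegular (affineBlowup 𝔔)) :
    ∃ (V : X.Opens), ι ⟨𝔭, h𝔭.isPrime⟩ ∈ V ∧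
      (∀ t : X, t ∉ Scheme.regularLocus X → t ∈ V → t = ι ⟨𝔭, h𝔭.isPrime⟩) ∧
      ∃ (Y : Scheme.{0}) (ρ : Y ⟶ V), IsProper ρ ∧ Scheme.IsRegular Y ∧
        IsIso (ρ ∣_ (V.ι ⁻¹ᵁ ⟨Scheme.regularLocus X, isOpen_regularLocus_of_locallyOfFiniteType_field f⟩)) ∧
        Dense ((ρ ⁻¹ᵁ (V.ι ⁻¹ᵁ ⟨Scheme.regularLocus X,
          isOpen_regularLocus_of_locallyOfFiniteType_field f⟩) : Y.Opens) : Set Y) := by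
  haveI : IsNoetherianRing B := Algebra.FiniteType.isNoetherianRing k B
  haveI : IsNoetherianRing C := Algebra.FiniteType.isNoetherianRing B C
  obtain ⟨g, hg, hle⟩ := FibreReduced.exists_away_fibre_reduced 𝔭 𝔔 hunr
  exact hloc_of_pointBlowup_flat_chart_away k X f ι hι 𝔭 h𝔭0 hsing hregB 𝔔 hover g hg hle hregQ

/-- **RESOLUTION OF ISOLATED SINGULARITIES THAT ARE RESOLVED ÉTALE-LOCALLY BY ONE POINT BLOW-UP.** Let `X` be an
integral `k`-scheme locally of finite type (any field `k`) with finitely many singular points, each of which is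
`ι 𝔭` for an affine open `ι : Spec B → X`, a maximal `𝔭 ≠ 0` with `Spec B ∖ {𝔭}` regular, and a flat finitely
presented `B`-algebra `C` with a prime `𝔔` over `𝔭`, unramified there, such that `Bl_𝔔(Spec C)` is regular (e.g. an
étale chart by a Veronese cone `𝔸ⁿ/μ_r` at its vertex). Then `X` has a resolution of singularities.
[cite: Kollar2007, §2.2] -/
theorem hasResolution_of_pointBlowup_flat_charts (k : Type) [Field k] (X : Scheme.{0}) [IsIntegral X]
    (f : X ⟶ Spec (.of k)) [LocallyOfFiniteType f] (hfin : (Scheme.regularLocus X)ᶜ.Finite)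
    (hchart : ∀ s : X, s ∉ Scheme.regularLocus X →
      ∃ (B C : Type) (_ : CommRing B) (_ : CommRing C) (_ : Algebra B C) (_ : IsDomain B) (_ : Algebra k B)
        (_ : Algebra.FiniteType k B) (_ : Module.Flat B C) (_ : Algebra.FinitePresentation B C)
        (ι : Spec (.of B) ⟶ X) (_ : IsOpenImmersion ι)
        (_ : ι ≫ f = Spec.map (CommRingCat.ofHom (algebraMap k B)))
        (𝔭 : Ideal B) (h𝔭 : 𝔭.IsMaximal) (_ : 𝔭 ≠ ⊥) (_ : ι ⟨𝔭, h𝔭.isPrime⟩ = s)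
        (_ : ∀ P : Spec (.of B), P.asIdeal ≠ 𝔭 → P ∈ Scheme.regularLocus (Spec (.of B)))
        (𝔔 : Ideal C) (_ : 𝔔.IsPrime), 𝔭 ≤ 𝔔.comap (algebraMap B C) ∧
          𝔭.map (algebraMap B (Localization.AtPrime 𝔔)) =
            IsLocalRing.maximalIdeal (Localization.AtPrime 𝔔) ∧
          Scheme.IsRegular (affineBlowup 𝔔)) :
    Scheme.HasResolution X := by
  refine IsolatedGlue.hasResolution_of_finite_singularLocus_of_local k X f hfin fun s hs => ?_
  obtain ⟨B, C, _, _, _, _, _, _, _, _, ι, _, hι, 𝔭, h𝔭, h𝔭0, hιs, hregB, 𝔔, _, hover, hunr, hregQ⟩ :=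
    hchart s hs
  subst hιs
  exact hloc_of_pointBlowup_flat_chart k X f ι hι 𝔭 h𝔭0 hs hregB 𝔔 hover hunr hregQ

end Summit.ResolutionOfSingularities.ResolutionOfSingularities.Theorems.FRationalResolution.PointBlowupEtale

end
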